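import Summits.ValiantsHypothesis.ValiantsHypothesis.Theorems.NewtonTauWeak.Negative.AlignedPeelingSumset

/-!
# `NewtonTauWeak` (stmt-5904), line `aligned-peeling` refuted — part 3: the two-level corner design (negative lane)

The series `Theorems/NewtonTauWeak/Negative/AlignedPeeling*.lean` refutes the load-bearing stub `stub_alignedPeeling`
(`∃ C c, AlignedPeeling C c`) of the registered line `aligned-peeling` of crux `NewtonTauWeak`
(stmt-ValiantsHypothesis-5904); see `AlignedPeelingSumset.lean` for the overview.  The LINE dies; the crux itself
stays OPEN; nothing here bears on `VP ≠ VNP`.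

This file defines the design and its bookkeeping: lattice points `pt`, side `D = side n = 16 n³ + 16`, the corners
`corner D s` of the triangle, the cone-coordinate points `phi D s X Y` (`φ₀(X,Y) = (X,Y)`, `φ₁ = (D-X-Y, Y)`,
`φ₂ = (Y, D-X-Y)`), the cone functionals `cval` with their linear forms `xi0/xi1` (`cval_eq`), the factor supports
`Tgen D X Y = {3 corners, φ₀, φ₁, φ₂}` with the value table `cval_far_or`, the cone property `cone_decomp`, the data
`cX n i, cY n i` (`(1,1)` for the guard factor `i = 0`, `(1+(n-i)², 1+i²)` for the chain factors), the family
`Tfam`, the product `desP`, the deleted points `Dels` (summits `summitPt` and guards `guardPt`), the refuting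
polynomial `desF = desP - onesPoly Dels`, and the instance data `gfam` (`onesPoly ∘ Tfam`, and the constant `1`) and
`pfam` (`1` and `-onesPoly Dels`) with `sum_pfam_mul_prod : Σ_k pfam k * Π_i gfam k i = desF`.  [folklore]
-/

set_option linter.dupNamespace false
set_option linter.unusedSimpArgs false

namespace Summit.ValiantsHypothesis.ValiantsHypothesis.Theorems.NewtonTauWeak.Negative.AlignedPeelingCex

open scoped BigOperators
open MvPolynomial Finset
open Summit.ValiantsHypothesis.ValiantsHypothesis.Theorems.NewtonTauWeak.Negative (vert)

noncomputable section

/-! ## C.1 The design: lattice points, corners, cone coordinates -/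

/-- The lattice point `(x, y)`. -/
def pt (x y : ℕ) : Fin 2 →₀ ℕ := Finsupp.single 0 x + Finsupp.single 1 y

/-- First coordinate of `pt`. -/
@[simp] theorem pt_apply_zero (x y : ℕ) : pt x y 0 = x := by simp [pt]

/-- Second coordinate of `pt`. -/
@[simp] theorem pt_apply_one (x y : ℕ) : pt x y 1 = y := by simp [pt]

/-- Every lattice point is a `pt`. -/
theorem eq_pt (e : Fin 2 →₀ ℕ) : e = pt (e 0) (e 1) := by
  ext k; fin_cases k <;> simp

/-- Injectivity of `pt`. -/
theorem pt_inj {x y x' y' : ℕ} (h : pt x y = pt x' y') : x = x' ∧ y = y' :=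
  ⟨by simpa using congrArg (fun e : Fin 2 →₀ ℕ => e 0) h, by simpa using congrArg (fun e : Fin 2 →₀ ℕ => e 1) h⟩

/-- Side length of the design triangle: `D = 16 n³ + 16`. -/
def side (n : ℕ) : ℕ := 16 * n ^ 3 + 16

/-- The three corners `c₀ = (0,0)`, `c₁ = (D,0)`, `c₂ = (0,D)` of the triangle. -/
def corner (D : ℕ) (s : Fin 3) : Fin 2 →₀ ℕ :=
  if s.val = 0 then pt 0 0 else if s.val = 1 then pt D 0 else pt 0 D

/-- The lattice point with CONE COORDINATES `(X, Y)` at corner `s` (`c_s + X e_s + Y e'_s`, unimodular cones):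
`φ₀(X,Y) = (X,Y)`, `φ₁(X,Y) = (D-X-Y, Y)`, `φ₂(X,Y) = (Y, D-X-Y)`. -/
def phi (D : ℕ) (s : Fin 3) (X Y : ℕ) : Fin 2 →₀ ℕ :=
  if s.val = 0 then pt X Y else if s.val = 1 then pt (D - X - Y) Y else pt Y (D - X - Y)

/-- The affine cone functional at corner `s` with weights `(A, B)`: `A · (first cone coordinate) + B · (second)`. -/
def cval (D : ℕ) (s : Fin 3) (A B : ℝ) (t : Fin 2 →₀ ℕ) : ℝ :=
  if s.val = 0 then A * t 0 + B * t 1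
  else if s.val = 1 then A * ((D : ℝ) - t 0 - t 1) + B * t 1
  else A * ((D : ℝ) - t 0 - t 1) + B * t 0

/-- First coefficient of the linear form realising `cval` at corner `s`. -/
def xi0 (s : Fin 3) (A B : ℝ) : ℝ := if s.val = 0 then A else if s.val = 1 then -A else B - A

/-- Second coefficient of the linear form realising `cval` at corner `s`. -/
def xi1 (s : Fin 3) (A B : ℝ) : ℝ := if s.val = 0 then B else if s.val = 1 then B - A else -A

/-- The cone functional is the linear form minus its value at the corner. -/
theorem cval_eq (D : ℕ) (s : Fin 3) (A B : ℝ) (t : Fin 2 →₀ ℕ) :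
    cval D s A B t = fv (xi0 s A B) (xi1 s A B) t - fv (xi0 s A B) (xi1 s A B) (corner D s) := by
  fin_cases s <;> simp [cval, xi0, xi1, fv, corner] <;> ring

/-- The cone functional vanishes at its own corner. -/
theorem cval_corner_self (D : ℕ) (s : Fin 3) (A B : ℝ) : cval D s A B (corner D s) = 0 := by
  fin_cases s <;> simp [cval, corner]

/-- The cone functional on its own cone point `φ_s(X,Y)` is `A X + B Y`. -/
theorem cval_phi_self (D : ℕ) (s : Fin 3) (A B : ℝ) (X Y : ℕ) (hXY : X + Y ≤ D) :
    cval D s A B (phi D s X Y) = A * X + B * Y := by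
  have hcast : ((D - X - Y : ℕ) : ℝ) = (D : ℝ) - X - Y := by
    rw [Nat.cast_sub (by omega : Y ≤ D - X), Nat.cast_sub (by omega : X ≤ D)]
  fin_cases s <;>
    simp only [cval, phi, pt_apply_zero, pt_apply_one, hcast, Fin.isValue, Nat.reduceEqDiff, ↓reduceIte] <;> ring

/-- Membership in a design factor support. -/
def Tgen (D X Y : ℕ) : Finset (Fin 2 →₀ ℕ) :=
  {corner D 0, corner D 1, corner D 2, phi D 0 X Y, phi D 1 X Y, phi D 2 X Y}

/-- The six alternatives for a point of `Tgen D X Y`. -/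
theorem mem_Tgen_iff (D X Y : ℕ) (t : Fin 2 →₀ ℕ) : t ∈ Tgen D X Y ↔
    t = corner D 0 ∨ t = corner D 1 ∨ t = corner D 2 ∨ t = phi D 0 X Y ∨ t = phi D 1 X Y ∨ t = phi D 2 X Y := by
  simp [Tgen]

/-- Corners belong to every design factor support. -/
theorem corner_mem_Tgen (D X Y : ℕ) (s : Fin 3) : corner D s ∈ Tgen D X Y := by
  fin_cases s <;> simp [Tgen]

/-- Cone points belong to the design factor support. -/
theorem phi_mem_Tgen (D X Y : ℕ) (s : Fin 3) : phi D s X Y ∈ Tgen D X Y := by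
  fin_cases s <;> simp [Tgen]

/-- `#Tgen ≤ 6`. -/
theorem card_Tgen_le (D X Y : ℕ) : (Tgen D X Y).card ≤ 6 := by
  unfold Tgen
  refine (Finset.card_insert_le _ _).trans ?_
  refine (Nat.succ_le_succ (Finset.card_insert_le _ _)).trans ?_
  refine (Nat.succ_le_succ (Nat.succ_le_succ (Finset.card_insert_le _ _))).trans ?_
  refine (Nat.succ_le_succ (Nat.succ_le_succ (Nat.succ_le_succ (Finset.card_insert_le _ _)))).trans ?_
  refine (Nat.succ_le_succ (Nat.succ_le_succ (Nat.succ_le_succ (Nat.succ_le_succ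
    (Finset.card_insert_le _ _))))).trans ?_
  simp

/-- Points of a design factor lie in the triangle `x + y ≤ D`. -/
theorem tri_of_mem_Tgen (D X Y : ℕ) (hXY : X + Y ≤ D) (t : Fin 2 →₀ ℕ) (ht : t ∈ Tgen D X Y) :
    t 0 + t 1 ≤ D := by
  rcases (mem_Tgen_iff D X Y t).mp ht with rfl | rfl | rfl | rfl | rfl | rfl <;>
    simp [corner, phi] <;> omega

/-- **Value table.**  For `A, B ≥ 0` and a point `t` of a design factor with cone data `(X, Y)`, seen from corner
`s`: `t` is the corner itself, or the factor's own cone point `φ_s(X,Y)`, or it is FAR: its cone functional is at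
least `min(A,B) · (D - X - Y)`. -/
theorem cval_far_or (D X Y : ℕ) (hXY : X + Y ≤ D) (s : Fin 3) (A B : ℝ) (hA : 0 ≤ A) (hB : 0 ≤ B)
    (t : Fin 2 →₀ ℕ) (ht : t ∈ Tgen D X Y) :
    t = corner D s ∨ t = phi D s X Y ∨ min A B * ((D : ℝ) - X - Y) ≤ cval D s A B t := by
  have hcast : ((D - X - Y : ℕ) : ℝ) = (D : ℝ) - X - Y := by
    rw [Nat.cast_sub (by omega : Y ≤ D - X), Nat.cast_sub (by omega : X ≤ D)]
  have hXYr : (X : ℝ) + Y ≤ D := by exact_mod_cast hXY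
  have hX : (0 : ℝ) ≤ X := by positivity
  have hY : (0 : ℝ) ≤ Y := by positivity
  have hmA : min A B ≤ A := min_le_left _ _
  have hmB : min A B ≤ B := min_le_right _ _
  have hm0 : min A B * ((D : ℝ) - X - Y) ≤ A * ((D : ℝ) - X - Y) :=
    mul_le_mul_of_nonneg_right hmA (by linarith)
  have hm1 : min A B * ((D : ℝ) - X - Y) ≤ B * ((D : ℝ) - X - Y) :=
    mul_le_mul_of_nonneg_right hmB (by linarith)
  have hDXY : (0 : ℝ) ≤ (D : ℝ) - X - Y := by linarith
  have hXYD : (0 : ℝ) ≤ (X : ℝ) + Y := by positivity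
  rcases (mem_Tgen_iff D X Y t).mp ht with rfl | rfl | rfl | rfl | rfl | rfl
  · fin_cases s
    · exact Or.inl rfl
    · refine Or.inr (Or.inr ?_)
      simp only [cval, corner, phi, pt_apply_zero, pt_apply_one, hcast, Nat.cast_zero, Fin.isValue,
        Fin.val_zero, Fin.val_one, Fin.val_two, Nat.reduceEqDiff, ↓reduceIte]
      nlinarith [mul_nonneg hA hX, mul_nonneg hA hY, mul_nonneg hB hX, mul_nonneg hB hY,
        mul_nonneg hA hDXY, mul_nonneg hB hDXY, mul_nonneg (le_min hA hB) hXYD]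
    · refine Or.inr (Or.inr ?_)
      simp only [cval, corner, phi, pt_apply_zero, pt_apply_one, hcast, Nat.cast_zero, Fin.isValue,
        Fin.val_zero, Fin.val_one, Fin.val_two, Nat.reduceEqDiff, ↓reduceIte]
      nlinarith [mul_nonneg hA hX, mul_nonneg hA hY, mul_nonneg hB hX, mul_nonneg hB hY,
        mul_nonneg hA hDXY, mul_nonneg hB hDXY, mul_nonneg (le_min hA hB) hXYD]
  · fin_cases s
    · refine Or.inr (Or.inr ?_)
      simp only [cval, corner, phi, pt_apply_zero, pt_apply_one, hcast, Nat.cast_zero, Fin.isValue,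
        Fin.val_zero, Fin.val_one, Fin.val_two, Nat.reduceEqDiff, ↓reduceIte]
      nlinarith [mul_nonneg hA hX, mul_nonneg hA hY, mul_nonneg hB hX, mul_nonneg hB hY,
        mul_nonneg hA hDXY, mul_nonneg hB hDXY, mul_nonneg (le_min hA hB) hXYD]
    · exact Or.inl rfl
    · refine Or.inr (Or.inr ?_)
      simp only [cval, corner, phi, pt_apply_zero, pt_apply_one, hcast, Nat.cast_zero, Fin.isValue,
        Fin.val_zero, Fin.val_one, Fin.val_two, Nat.reduceEqDiff, ↓reduceIte]
      nlinarith [mul_nonneg hA hX, mul_nonneg hA hY, mul_nonneg hB hX, mul_nonneg hB hY,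
        mul_nonneg hA hDXY, mul_nonneg hB hDXY, mul_nonneg (le_min hA hB) hXYD]
  · fin_cases s
    · refine Or.inr (Or.inr ?_)
      simp only [cval, corner, phi, pt_apply_zero, pt_apply_one, hcast, Nat.cast_zero, Fin.isValue,
        Fin.val_zero, Fin.val_one, Fin.val_two, Nat.reduceEqDiff, ↓reduceIte]
      nlinarith [mul_nonneg hA hX, mul_nonneg hA hY, mul_nonneg hB hX, mul_nonneg hB hY,
        mul_nonneg hA hDXY, mul_nonneg hB hDXY, mul_nonneg (le_min hA hB) hXYD]
    · refine Or.inr (Or.inr ?_)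
      simp only [cval, corner, phi, pt_apply_zero, pt_apply_one, hcast, Nat.cast_zero, Fin.isValue,
        Fin.val_zero, Fin.val_one, Fin.val_two, Nat.reduceEqDiff, ↓reduceIte]
      nlinarith [mul_nonneg hA hX, mul_nonneg hA hY, mul_nonneg hB hX, mul_nonneg hB hY,
        mul_nonneg hA hDXY, mul_nonneg hB hDXY, mul_nonneg (le_min hA hB) hXYD]
    · exact Or.inl rfl
  · fin_cases s
    · exact Or.inr (Or.inl rfl)
    · refine Or.inr (Or.inr ?_)
      simp only [cval, corner, phi, pt_apply_zero, pt_apply_one, hcast, Nat.cast_zero, Fin.isValue,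
        Fin.val_zero, Fin.val_one, Fin.val_two, Nat.reduceEqDiff, ↓reduceIte]
      nlinarith [mul_nonneg hA hX, mul_nonneg hA hY, mul_nonneg hB hX, mul_nonneg hB hY,
        mul_nonneg hA hDXY, mul_nonneg hB hDXY, mul_nonneg (le_min hA hB) hXYD]
    · refine Or.inr (Or.inr ?_)
      simp only [cval, corner, phi, pt_apply_zero, pt_apply_one, hcast, Nat.cast_zero, Fin.isValue,
        Fin.val_zero, Fin.val_one, Fin.val_two, Nat.reduceEqDiff, ↓reduceIte]
      nlinarith [mul_nonneg hA hX, mul_nonneg hA hY, mul_nonneg hB hX, mul_nonneg hB hY,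
        mul_nonneg hA hDXY, mul_nonneg hB hDXY, mul_nonneg (le_min hA hB) hXYD]
  · fin_cases s
    · refine Or.inr (Or.inr ?_)
      simp only [cval, corner, phi, pt_apply_zero, pt_apply_one, hcast, Nat.cast_zero, Fin.isValue,
        Fin.val_zero, Fin.val_one, Fin.val_two, Nat.reduceEqDiff, ↓reduceIte]
      nlinarith [mul_nonneg hA hX, mul_nonneg hA hY, mul_nonneg hB hX, mul_nonneg hB hY,
        mul_nonneg hA hDXY, mul_nonneg hB hDXY, mul_nonneg (le_min hA hB) hXYD]
    · exact Or.inr (Or.inl rfl)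
    · refine Or.inr (Or.inr ?_)
      simp only [cval, corner, phi, pt_apply_zero, pt_apply_one, hcast, Nat.cast_zero, Fin.isValue,
        Fin.val_zero, Fin.val_one, Fin.val_two, Nat.reduceEqDiff, ↓reduceIte]
      nlinarith [mul_nonneg hA hX, mul_nonneg hA hY, mul_nonneg hB hX, mul_nonneg hB hY,
        mul_nonneg hA hDXY, mul_nonneg hB hDXY, mul_nonneg (le_min hA hB) hXYD]
  · fin_cases s
    · refine Or.inr (Or.inr ?_)
      simp only [cval, corner, phi, pt_apply_zero, pt_apply_one, hcast, Nat.cast_zero, Fin.isValue,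
        Fin.val_zero, Fin.val_one, Fin.val_two, Nat.reduceEqDiff, ↓reduceIte]
      nlinarith [mul_nonneg hA hX, mul_nonneg hA hY, mul_nonneg hB hX, mul_nonneg hB hY,
        mul_nonneg hA hDXY, mul_nonneg hB hDXY, mul_nonneg (le_min hA hB) hXYD]
    · refine Or.inr (Or.inr ?_)
      simp only [cval, corner, phi, pt_apply_zero, pt_apply_one, hcast, Nat.cast_zero, Fin.isValue,
        Fin.val_zero, Fin.val_one, Fin.val_two, Nat.reduceEqDiff, ↓reduceIte]
      nlinarith [mul_nonneg hA hX, mul_nonneg hA hY, mul_nonneg hB hX, mul_nonneg hB hY,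
        mul_nonneg hA hDXY, mul_nonneg hB hDXY, mul_nonneg (le_min hA hB) hXYD]
    · exact Or.inr (Or.inl rfl)

/-! ## C.2 Arithmetic of `pt`, cone property, chain data -/

/-- Addition of lattice points in coordinates. -/
theorem pt_add (x y x' y' : ℕ) : pt x y + pt x' y' = pt (x + x') (y + y') := by
  ext k; fin_cases k <;> simp

/-- Scalar multiples of lattice points in coordinates. -/
theorem nsmul_pt (m x y : ℕ) : m • pt x y = pt (m * x) (m * y) := by
  ext k; fin_cases k <;> simp

/-- Coordinates of the corners. -/
theorem corner_eq_pt (D : ℕ) (s : Fin 3) :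
    corner D s = pt (if s.val = 1 then D else 0) (if s.val = 2 then D else 0) := by
  fin_cases s <;> simp [corner]

/-- The corners are pairwise distinct when `D ≠ 0`. -/
theorem corner_injective (D : ℕ) (hD : D ≠ 0) {s s' : Fin 3} (h : corner D s = corner D s') : s = s' := by
  fin_cases s <;> fin_cases s' <;>
    simp [corner, Fin.isValue, Nat.reduceEqDiff] at h ⊢ <;>
    first | rfl | (have := pt_inj h; omega)

/-- **Cone property** of the triangle at corner `s`: every lattice point `t` with `t₀ + t₁ ≤ D` is
`c_s + α (c_{s+1} - c_s) + β (c_{s+2} - c_s)` with `α, β ≥ 0` (the other two corners, in either order). -/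
theorem cone_decomp (D : ℕ) (hD : 0 < D) (s a b : Fin 3) (hab : a ≠ b) (has : a ≠ s) (hbs : b ≠ s)
    (t : Fin 2 →₀ ℕ) (ht : t 0 + t 1 ≤ D) :
    ∃ α β : ℝ, 0 ≤ α ∧ 0 ≤ β ∧
      ((t 0 : ℝ) - (corner D s) 0 = α * (((corner D a) 0 : ℝ) - (corner D s) 0) +
        β * (((corner D b) 0 : ℝ) - (corner D s) 0)) ∧
      ((t 1 : ℝ) - (corner D s) 1 = α * (((corner D a) 1 : ℝ) - (corner D s) 1) +
        β * (((corner D b) 1 : ℝ) - (corner D s) 1)) := by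
  have hDr : (0 : ℝ) < D := by exact_mod_cast hD
  have hx : (0 : ℝ) ≤ t 0 := by positivity
  have hy : (0 : ℝ) ≤ t 1 := by positivity
  have hsum : ((t 0 : ℕ) : ℝ) + t 1 ≤ D := by exact_mod_cast ht
  have hz : (0 : ℝ) ≤ ((D : ℝ) - t 0 - t 1) / D := div_nonneg (by linarith) hDr.le
  have hx' : (0 : ℝ) ≤ (t 0 : ℝ) / D := div_nonneg hx hDr.le
  have hy' : (0 : ℝ) ≤ (t 1 : ℝ) / D := div_nonneg hy hDr.le
  have hDne : (D : ℝ) ≠ 0 := hDr.ne'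
  -- coefficients: weight of corner 0 is (D - x - y)/D, of corner 1 is x/D, of corner 2 is y/D
  fin_cases s <;> fin_cases a <;> fin_cases b <;> simp at hab has hbs <;>
    simp only [corner, Fin.isValue, Fin.val_zero, Fin.val_one, Fin.val_two, Nat.reduceEqDiff, ↓reduceIte,
      pt_apply_zero, pt_apply_one, Nat.cast_zero]
  · exact ⟨(t 0 : ℝ) / D, (t 1 : ℝ) / D, hx', hy', by field_simp; ring, by field_simp; ring⟩
  · exact ⟨(t 1 : ℝ) / D, (t 0 : ℝ) / D, hy', hx', by field_simp; ring, by field_simp; ring⟩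
  · exact ⟨((D : ℝ) - t 0 - t 1) / D, (t 1 : ℝ) / D, hz, hy', by field_simp; ring, by field_simp; ring⟩
  · exact ⟨(t 1 : ℝ) / D, ((D : ℝ) - t 0 - t 1) / D, hy', hz, by field_simp; ring, by field_simp; ring⟩
  · exact ⟨((D : ℝ) - t 0 - t 1) / D, (t 0 : ℝ) / D, hz, hx', by field_simp; ring, by field_simp; ring⟩
  · exact ⟨(t 0 : ℝ) / D, ((D : ℝ) - t 0 - t 1) / D, hx', hz, by field_simp; ring, by field_simp; ring⟩

/-- Cone datum `X` of factor `i`: `1` for the guard factor `i = 0`, `1 + (n - i)²` for the chain factors. -/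
def cX (n : ℕ) (i : Fin (n + 1)) : ℕ := if (i : ℕ) = 0 then 1 else 1 + (n - i) ^ 2

/-- Cone datum `Y` of factor `i`: `1` for the guard factor `i = 0`, `1 + i²` for the chain factors. -/
def cY (n : ℕ) (i : Fin (n + 1)) : ℕ := if (i : ℕ) = 0 then 1 else 1 + (i : ℕ) ^ 2

/-- `X ≥ 1`. -/
theorem one_le_cX (n : ℕ) (i : Fin (n + 1)) : 1 ≤ cX n i := by
  unfold cX; split_ifs <;> omega

/-- `Y ≥ 1`. -/
theorem one_le_cY (n : ℕ) (i : Fin (n + 1)) : 1 ≤ cY n i := by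
  unfold cY; split_ifs <;> omega

/-- `Y ≥ 2` for chain factors. -/
theorem two_le_cY (n : ℕ) (i : Fin (n + 1)) (hi : (i : ℕ) ≠ 0) : 2 ≤ cY n i := by
  unfold cY; rw [if_neg hi]
  have : 1 ≤ (i : ℕ) ^ 2 := Nat.one_le_pow _ _ (Nat.pos_of_ne_zero hi)
  omega

/-- The guard factor's data are `(1, 1)`. -/
theorem cXY_zero (n : ℕ) : cX n 0 = 1 ∧ cY n 0 = 1 := by
  simp [cX, cY]

/-- `X + Y ≤ 2 + n²`. -/
theorem cXY_le (n : ℕ) (i : Fin (n + 1)) : cX n i + cY n i ≤ 2 + n ^ 2 := by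
  unfold cX cY
  have hi : (i : ℕ) ≤ n := Nat.lt_succ_iff.mp i.isLt
  split_ifs
  · nlinarith
  · have h1 : (n - (i : ℕ)) ^ 2 + (i : ℕ) ^ 2 ≤ n ^ 2 := by
      have hsub : n - (i : ℕ) + (i : ℕ) = n := Nat.sub_add_cancel hi
      calc (n - (i : ℕ)) ^ 2 + (i : ℕ) ^ 2 ≤ (n - (i : ℕ) + (i : ℕ)) ^ 2 := by nlinarith
        _ = n ^ 2 := by rw [hsub]
    omega

/-- Crude bound used repeatedly: `n² + 5 ≤ D`. -/
theorem sq_le_side (n : ℕ) : n ^ 2 + 5 ≤ side n := by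
  unfold side
  rcases Nat.eq_zero_or_pos n with rfl | hn
  · simp
  · have : n ^ 2 ≤ n ^ 3 :=
      calc n ^ 2 = n ^ 2 * 1 := by ring
        _ ≤ n ^ 2 * n := Nat.mul_le_mul_left _ hn
        _ = n ^ 3 := by ring
    omega

/-- The side dominates the data: `X + Y + 3 ≤ D`. -/
theorem cXY_le_side (n : ℕ) (i : Fin (n + 1)) : cX n i + cY n i + 3 ≤ side n := by
  have := cXY_le n i
  have := sq_le_side n
  omega

/-! ## C.3 The family and its polynomials -/

/-- The design family of factor supports `T_i = Tgen D (X_i) (Y_i)`, `i = 0, …, n`. -/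
def Tfam (n : ℕ) (i : Fin (n + 1)) : Finset (Fin 2 →₀ ℕ) := Tgen (side n) (cX n i) (cY n i)

/-- The design product `P = Π_i onesPoly (T_i)`. -/
def desP (n : ℕ) : MvPolynomial (Fin 2) ℂ := ∏ i, onesPoly (Tfam n i)

/-- The summit of the product polygon at corner `s`: `(n+1) • c_s`. -/
def summitPt (n : ℕ) (s : Fin 3) : Fin 2 →₀ ℕ := (n + 1) • corner (side n) s

/-- The guard point at corner `s`: `n • c_s + φ_s(1,1)`. -/
def guardPt (n : ℕ) (s : Fin 3) : Fin 2 →₀ ℕ := n • corner (side n) s + phi (side n) s 1 1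

/-- The chain target at corner `s` for factor `i`: `n • c_s + φ_s(X_i, Y_i)`. -/
def targetPt (n : ℕ) (s : Fin 3) (i : Fin (n + 1)) : Fin 2 →₀ ℕ :=
  n • corner (side n) s + phi (side n) s (cX n i) (cY n i)

/-- The six deleted points: summits and guards. -/
def Dels (n : ℕ) : Finset (Fin 2 →₀ ℕ) :=
  Finset.univ.biUnion fun s : Fin 3 => {summitPt n s, guardPt n s}

/-- The refuting polynomial `F = P - Σ_{d ∈ Dels} X^d`. -/
def desF (n : ℕ) : MvPolynomial (Fin 2) ℂ := desP n - onesPoly (Dels n)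

/-- The two products of the instance: `g 0 i = onesPoly (T_i)`, `g 1 i = 1`. -/
def gfam (n : ℕ) (k : Fin 2) (i : Fin (n + 1)) : MvPolynomial (Fin 2) ℂ :=
  if (k : ℕ) = 0 then onesPoly (Tfam n i) else 1

/-- The two multipliers: `p 0 = 1`, `p 1 = - onesPoly Dels`. -/
def pfam (n : ℕ) (k : Fin 2) : MvPolynomial (Fin 2) ℂ := if (k : ℕ) = 0 then 1 else -onesPoly (Dels n)

/-- The instance's combination is `F`. -/
theorem sum_pfam_mul_prod (n : ℕ) : ∑ k, pfam n k * ∏ i, gfam n k i = desF n := by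
  rw [Fin.sum_univ_two]
  simp [pfam, gfam, desP, desF, sub_eq_add_neg]

/-- Summits are deleted. -/
theorem summitPt_mem_Dels (n : ℕ) (s : Fin 3) : summitPt n s ∈ Dels n := by
  unfold Dels; simp only [Finset.mem_biUnion, Finset.mem_univ, true_and]; exact ⟨s, by simp⟩

/-- Guards are deleted. -/
theorem guardPt_mem_Dels (n : ℕ) (s : Fin 3) : guardPt n s ∈ Dels n := by
  unfold Dels; simp only [Finset.mem_biUnion, Finset.mem_univ, true_and]; exact ⟨s, by simp⟩

/-- Membership in `Dels`. -/
theorem mem_Dels_iff (n : ℕ) (e : Fin 2 →₀ ℕ) : e ∈ Dels n ↔ ∃ s, e = summitPt n s ∨ e = guardPt n s := by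
  unfold Dels; simp

/-- `#Dels ≤ 6`. -/
theorem card_Dels_le (n : ℕ) : (Dels n).card ≤ 6 := by
  unfold Dels
  refine (Finset.card_biUnion_le).trans ?_
  calc ∑ s : Fin 3, ({summitPt n s, guardPt n s} : Finset (Fin 2 →₀ ℕ)).card ≤ ∑ _s : Fin 3, 2 :=
        Finset.sum_le_sum fun s _ => Finset.card_le_two
    _ = 6 := by simp

/-- Sparsity of the factors: at most `6` monomials. -/
theorem card_support_gfam_le (n : ℕ) (k : Fin 2) (i : Fin (n + 1)) : (gfam n k i).support.card ≤ 6 := by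
  unfold gfam
  split_ifs
  · rw [support_onesPoly]; exact card_Tgen_le _ _ _
  · refine (Finset.card_le_card (MvPolynomial.support_one.le)).trans ?_
    simp

/-- Sparsity of the multipliers: at most `6` monomials. -/
theorem card_support_pfam_le (n : ℕ) (k : Fin 2) : (pfam n k).support.card ≤ 6 := by
  unfold pfam
  split_ifs
  · refine (Finset.card_le_card (MvPolynomial.support_one.le)).trans ?_
    simp
  · rw [MvPolynomial.support_neg, support_onesPoly]; exact card_Dels_le n

end

end Summit.ValiantsHypothesis.ValiantsHypothesis.Theorems.NewtonTauWeak.Negative.AlignedPeelingCex
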